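import Summits.Ventures.LatticeQCDFlow.Scoring.SchwingerDysonOnePlaquette
import Mathlib.Analysis.SpecialFunctions.Integrals.Basic
import Mathlib.Analysis.SpecialFunctions.Exponential
import Mathlib.Analysis.SpecificLimits.Basic
import HarnessLib

/-!
# Truncation bounds for the one-plaquette integrals `∫ w(θ) e^{β cos θ} dθ` (U(1) on `[0, 2π]`, SU(2) class angle on `[0, π]`)

HONEST FRAMING: exact (Metropolis-corrected) sampling algorithms for lattice gauge theory;
figures of merit are autocorrelation/cost numbers at stated couplings and volumes; no
continuum-physics claim.

Venture `LatticeQCDFlow` (cell pub-lqcd), sub-topic `Scoring`; FANOUT row 5 (`s0-sun-a`, S0-C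
implementation A — the 'exact 2-d plaquette oracle' column).  NEW WORK of the cell (placement rule):
the analytic half of a kernel-checked ENCLOSURE of the one-plaquette expectations
`onePlaquetteExpect β cos` (U(1), `= I₁(β)/I₀(β)`) and `onePlaquetteExpectSU2 β cos` (SU(2),
`= I₂(β)/I₁(β)`) of `Scoring/SchwingerDysonOnePlaquette.lean`; the rational certificates and the ten
reference-coupling enclosures are in `Scoring/OnePlaquetteEnclosures.lean`.  Elementary throughout —
no Bessel function is named:

1. `abs_exp_sub_sum_le` — Taylor remainder of `exp` with a geometric tail: for `|x| ≤ b` and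
   `2b ≤ K + 1`, `|e^x − Σ_{k<K} x^k/k!| ≤ 2 b^K / K!` (Mathlib's `expSeries_div_hasSum_exp`,
   `Nat.factorial_mul_pow_le_factorial`, `hasSum_geometric_two`).
2. `integral_cos_pow_eq_mul_cosMom` — `∫_0^L cos^k = L · r_k` whenever `sin L = 0`, with the rational
   Wallis sequence `cosMom`: `r_0 = 1, r_1 = 0, r_{k+2} = (k+1)/(k+2) · r_k` (Mathlib's `integral_cos_pow`).
3. `abs_integral_weight_exp_sub_le` — for a continuous weight `|w| ≤ 1` with cos-power moments
   `∫_0^L w cos^k = L · m_k` (`m_k` rational), `0 ≤ β`, `2β ≤ K + 1`: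
   `|∫_0^L w e^{β cos} − L Σ_{k<K} β^k m_k / k!| ≤ L · 2β^K/K!`.
4. The four instances: `abs_onePlaquetteZ_sub_le` / `abs_onePlaquetteN_sub_le` (U(1): `w = 1, cos`,
   `m_k = r_k, r_{k+1}`, `L = 2π`) and `abs_onePlaquetteZSU2_sub_le` / `abs_onePlaquetteNSU2_sub_le`
   (SU(2): `w = sin², cos·sin²`, `m_k = r_k − r_{k+2}, r_{k+1} − r_{k+3}`, `L = π`).
5. `div_mem_of_abs_sub_le` — seven rational inequalities between the truncated sums, the tail and
   `lo, hi` that put the ratio `N/Z` inside `[lo, hi]`.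
-/

namespace Summit.Ventures.LatticeQCDFlow.Scoring

open Real MeasureTheory intervalIntegral Finset
open scoped Nat Interval

/-! ### 1. Exponential Taylor remainder with a geometric tail -/

/-- The shifted exponential series sums to the Taylor remainder:
`Σ_n x^{n+K}/(n+K)! = e^x − Σ_{k<K} x^k/k!`. -/
theorem hasSum_exp_tail (x : ℝ) (K : ℕ) :
    HasSum (fun n : ℕ => x ^ (n + K) / ((n + K)! : ℝ))
      (Real.exp x - ∑ k ∈ range K, x ^ k / (k ! : ℝ)) := by
  have h : HasSum (fun n : ℕ => x ^ n / (n ! : ℝ)) (Real.exp x) := by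
    rw [Real.exp_eq_exp_ℝ]
    exact NormedSpace.expSeries_div_hasSum_exp x
  exact (hasSum_nat_add_iff' (f := fun n : ℕ => x ^ n / (n ! : ℝ)) K).mpr h

/-- Termwise geometric domination of the exponential tail: for `|x| ≤ b` and `2b ≤ K+1`,
`|x^{n+K}/(n+K)!| ≤ (b^K/K!)·(1/2)^n`. -/
theorem abs_exp_tail_term_le {x b : ℝ} (hx : |x| ≤ b) {K : ℕ} (hK : 2 * b ≤ K + 1) (n : ℕ) :
    |x ^ (n + K) / ((n + K)! : ℝ)| ≤ b ^ K / (K ! : ℝ) * (1 / 2) ^ n := by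
  have hb : 0 ≤ b := (abs_nonneg x).trans hx
  have hK1 : (0 : ℝ) < K + 1 := by positivity
  have hfacK : (0 : ℝ) < K ! := by positivity
  have hfac : (0 : ℝ) < (n + K)! := by positivity
  rw [abs_div, abs_pow, Nat.abs_cast]
  have h1 : |x| ^ (n + K) ≤ b ^ (n + K) := pow_le_pow_left₀ (abs_nonneg x) hx _
  have h2 : (K ! : ℝ) * ((K : ℝ) + 1) ^ n ≤ ((n + K)! : ℝ) := by
    have h := Nat.factorial_mul_pow_le_factorial (m := K) (n := n)
    rw [Nat.add_comm K n] at h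
    exact_mod_cast h
  have hden : (0 : ℝ) < (K ! : ℝ) * ((K : ℝ) + 1) ^ n := by positivity
  have hq : b / ((K : ℝ) + 1) ≤ 1 / 2 := by
    rw [div_le_iff₀ hK1]; linarith
  have hq0 : 0 ≤ b / ((K : ℝ) + 1) := by positivity
  calc |x| ^ (n + K) / ((n + K)! : ℝ)
      ≤ b ^ (n + K) / ((n + K)! : ℝ) := by gcongr
    _ ≤ b ^ (n + K) / ((K ! : ℝ) * ((K : ℝ) + 1) ^ n) :=
        div_le_div_of_nonneg_left (by positivity) hden h2
    _ = b ^ K / (K ! : ℝ) * (b / ((K : ℝ) + 1)) ^ n := by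
        rw [pow_add, div_pow]
        field_simp
    _ ≤ b ^ K / (K ! : ℝ) * (1 / 2) ^ n := by gcongr

/-- **Taylor remainder of `exp` with a geometric tail**: for `|x| ≤ b` and `2b ≤ K + 1`,
`|e^x − Σ_{k<K} x^k/k!| ≤ 2 b^K/K!`. -/
theorem abs_exp_sub_sum_le {x b : ℝ} (hx : |x| ≤ b) {K : ℕ} (hK : 2 * b ≤ K + 1) :
    |Real.exp x - ∑ k ∈ range K, x ^ k / (k ! : ℝ)| ≤ 2 * b ^ K / (K ! : ℝ) := by
  have hs := hasSum_exp_tail x K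
  have hg : HasSum (fun n : ℕ => b ^ K / (K ! : ℝ) * ((1 : ℝ) / 2) ^ n) (b ^ K / (K ! : ℝ) * 2) :=
    hasSum_geometric_two.mul_left _
  have hle := fun n => abs_exp_tail_term_le hx hK n
  have h1 : Real.exp x - ∑ k ∈ range K, x ^ k / (k ! : ℝ) ≤ b ^ K / (K ! : ℝ) * 2 :=
    hasSum_le (fun n => (le_abs_self _).trans (hle n)) hs hg
  have h2 : -(Real.exp x - ∑ k ∈ range K, x ^ k / (k ! : ℝ)) ≤ b ^ K / (K ! : ℝ) * 2 :=
    hasSum_le (fun n => (neg_le_abs _).trans (hle n)) hs.neg hg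
  have e : b ^ K / (K ! : ℝ) * 2 = 2 * b ^ K / (K ! : ℝ) := by ring
  rw [e] at h1 h2
  rw [abs_le]
  constructor <;> linarith

/-! ### 2. Cosine power moments: the rational Wallis sequence -/

/-- The Wallis ratios `r_k = (∫_0^L cos^k)/L` for any `L` with `sin L = 0`:
`r_0 = 1`, `r_1 = 0`, `r_{k+2} = (k+1)/(k+2) · r_k` (so `r_{2m} = (2m)!/(4^m (m!)²)`, `r_{odd} = 0`). -/
def cosMom : ℕ → ℚ
  | 0 => 1
  | 1 => 0
  | (k + 2) => (k + 1) / (k + 2) * cosMom k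

/-- `∫_0^L cos^k θ dθ = L · r_k` whenever `sin L = 0` (Mathlib's reduction formula `integral_cos_pow`;
the boundary terms carry a factor `sin L` or `sin 0`). -/
theorem integral_cos_pow_eq_mul_cosMom {L : ℝ} (hL : Real.sin L = 0) :
    ∀ k : ℕ, ∫ θ in (0 : ℝ)..L, Real.cos θ ^ k = L * ((cosMom k : ℚ) : ℝ)
  | 0 => by simp [cosMom]
  | 1 => by simp [cosMom, hL]
  | (k + 2) => by
      rw [integral_cos_pow, integral_cos_pow_eq_mul_cosMom hL k, hL, Real.sin_zero]
      simp only [cosMom]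
      push_cast
      ring

/-! ### 3. Truncating a weighted exponential integral -/

/-- **Truncation bound.**  For a continuous weight `w` with `|w| ≤ 1` whose cos-power moments on
`[0, L]` are `L · m_k` (`m_k` rational), and `0 ≤ β` with `2β ≤ K + 1`:
`|∫_0^L w(θ) e^{β cos θ} dθ − L · Σ_{k<K} β^k/k! · m_k| ≤ L · (2 β^K / K!)`. -/
theorem abs_integral_weight_exp_sub_le {w : ℝ → ℝ} (hw : Continuous w) (hw1 : ∀ θ, |w θ| ≤ 1)
    {L : ℝ} (hL : 0 ≤ L) {m : ℕ → ℚ}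
    (hm : ∀ k : ℕ, ∫ θ in (0 : ℝ)..L, w θ * Real.cos θ ^ k = L * ((m k : ℚ) : ℝ))
    {β : ℝ} (hβ : 0 ≤ β) {K : ℕ} (hK : 2 * β ≤ K + 1) :
    |(∫ θ in (0 : ℝ)..L, w θ * Real.exp (β * Real.cos θ))
      - L * ∑ k ∈ range K, β ^ k / (k ! : ℝ) * ((m k : ℚ) : ℝ)| ≤ L * (2 * β ^ K / (K ! : ℝ)) := by
  -- each term of the finite sum is an integral
  have hint : ∀ k : ℕ, IntervalIntegrable (fun θ => β ^ k / (k ! : ℝ) * (w θ * Real.cos θ ^ k))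
      volume (0 : ℝ) L := fun k =>
    (by fun_prop : Continuous fun θ => β ^ k / (k ! : ℝ) * (w θ * Real.cos θ ^ k)).intervalIntegrable
      _ _
  have hsum : L * ∑ k ∈ range K, β ^ k / (k ! : ℝ) * ((m k : ℚ) : ℝ)
      = ∫ θ in (0 : ℝ)..L, ∑ k ∈ range K, β ^ k / (k ! : ℝ) * (w θ * Real.cos θ ^ k) := by
    rw [intervalIntegral.integral_finsetSum (fun k _ => hint k), Finset.mul_sum]
    refine Finset.sum_congr rfl (fun k _ => ?_)
    rw [intervalIntegral.integral_const_mul, hm k]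
    ring
  have hexp : IntervalIntegrable (fun θ => w θ * Real.exp (β * Real.cos θ)) volume (0 : ℝ) L :=
    (by fun_prop : Continuous fun θ => w θ * Real.exp (β * Real.cos θ)).intervalIntegrable _ _
  have hfin : IntervalIntegrable
      (fun θ => ∑ k ∈ range K, β ^ k / (k ! : ℝ) * (w θ * Real.cos θ ^ k)) volume (0 : ℝ) L :=
    (by fun_prop : Continuous fun θ => ∑ k ∈ range K, β ^ k / (k ! : ℝ) * (w θ * Real.cos θ ^ k)).intervalIntegrable
      _ _
  rw [hsum, ← intervalIntegral.integral_sub hexp hfin]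
  -- pointwise: the difference is `w θ · (e^{β cos θ} − Σ (β cos θ)^k/k!)`
  have hpt : (fun θ => w θ * Real.exp (β * Real.cos θ)
        - ∑ k ∈ range K, β ^ k / (k ! : ℝ) * (w θ * Real.cos θ ^ k))
      = fun θ => w θ * (Real.exp (β * Real.cos θ)
        - ∑ k ∈ range K, (β * Real.cos θ) ^ k / (k ! : ℝ)) := by
    funext θ
    rw [mul_sub, Finset.mul_sum]
    congr 1
    refine Finset.sum_congr rfl (fun k _ => ?_)
    rw [mul_pow]
    ring
  rw [hpt]
  have hbound : ∀ θ ∈ Set.uIoc (0 : ℝ) L, ‖w θ * (Real.exp (β * Real.cos θ)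
      - ∑ k ∈ range K, (β * Real.cos θ) ^ k / (k ! : ℝ))‖ ≤ 2 * β ^ K / (K ! : ℝ) := by
    intro θ _
    rw [Real.norm_eq_abs, abs_mul]
    have hx : |β * Real.cos θ| ≤ β := by
      rw [abs_mul, abs_of_nonneg hβ]
      exact mul_le_of_le_one_right hβ (Real.abs_cos_le_one θ)
    have h2 := abs_exp_sub_sum_le hx hK
    have h3 : 0 ≤ |Real.exp (β * Real.cos θ) - ∑ k ∈ range K, (β * Real.cos θ) ^ k / (k ! : ℝ)| :=
      abs_nonneg _
    calc |w θ| * |Real.exp (β * Real.cos θ) - ∑ k ∈ range K, (β * Real.cos θ) ^ k / (k ! : ℝ)|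
        ≤ 1 * (2 * β ^ K / (K ! : ℝ)) := by gcongr; exact hw1 θ
      _ = 2 * β ^ K / (K ! : ℝ) := one_mul _
  have h := intervalIntegral.norm_integral_le_of_norm_le_const hbound
  rw [Real.norm_eq_abs, sub_zero, abs_of_nonneg hL] at h
  linarith

/-! ### 4. The four integrals of interest -/

/-- U(1) partition function: `|Z(β) − 2π Σ_{k<K} β^k r_k/k!| ≤ 2π · 2β^K/K!`. -/
theorem abs_onePlaquetteZ_sub_le {β : ℝ} (hβ : 0 ≤ β) {K : ℕ} (hK : 2 * β ≤ K + 1) :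
    |onePlaquetteZ β - 2 * π * ∑ k ∈ range K, β ^ k / (k ! : ℝ) * ((cosMom k : ℚ) : ℝ)|
      ≤ 2 * π * (2 * β ^ K / (K ! : ℝ)) := by
  have hm : ∀ k : ℕ, ∫ θ in (0 : ℝ)..(2 * π), (fun _ => (1 : ℝ)) θ * Real.cos θ ^ k
      = 2 * π * ((cosMom k : ℚ) : ℝ) := by
    intro k
    simp only [one_mul]
    exact integral_cos_pow_eq_mul_cosMom (by simp [Real.sin_two_pi]) k
  have h := abs_integral_weight_exp_sub_le (w := fun _ => (1 : ℝ)) continuous_const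
    (fun _ => by simp) (by positivity) hm hβ hK
  have hZ : onePlaquetteZ β = ∫ θ in (0 : ℝ)..(2 * π), (fun _ => (1 : ℝ)) θ * Real.exp (β * Real.cos θ) := by
    unfold onePlaquetteZ
    simp only [one_mul]
  rw [hZ]
  exact h

/-- U(1) numerator: `|∫_0^{2π} cos θ e^{β cos θ} − 2π Σ_{k<K} β^k r_{k+1}/k!| ≤ 2π · 2β^K/K!`. -/
theorem abs_onePlaquetteN_sub_le {β : ℝ} (hβ : 0 ≤ β) {K : ℕ} (hK : 2 * β ≤ K + 1) :
    |(∫ θ in (0 : ℝ)..(2 * π), Real.cos θ * Real.exp (β * Real.cos θ))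
      - 2 * π * ∑ k ∈ range K, β ^ k / (k ! : ℝ) * ((cosMom (k + 1) : ℚ) : ℝ)|
      ≤ 2 * π * (2 * β ^ K / (K ! : ℝ)) := by
  have hm : ∀ k : ℕ, ∫ θ in (0 : ℝ)..(2 * π), Real.cos θ * Real.cos θ ^ k
      = 2 * π * ((cosMom (k + 1) : ℚ) : ℝ) := by
    intro k
    have hpt : (fun θ => Real.cos θ * Real.cos θ ^ k) = fun θ => Real.cos θ ^ (k + 1) := by
      funext θ; rw [_root_.pow_succ']
    rw [hpt]
    exact integral_cos_pow_eq_mul_cosMom (by simp [Real.sin_two_pi]) (k + 1)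
  exact abs_integral_weight_exp_sub_le (w := Real.cos) Real.continuous_cos
    Real.abs_cos_le_one (by positivity) hm hβ hK

/-- SU(2) class-angle partition function:
`|Z₂(β) − π Σ_{k<K} β^k (r_k − r_{k+2})/k!| ≤ π · 2β^K/K!`. -/
theorem abs_onePlaquetteZSU2_sub_le {β : ℝ} (hβ : 0 ≤ β) {K : ℕ} (hK : 2 * β ≤ K + 1) :
    |onePlaquetteZSU2 β
      - π * ∑ k ∈ range K, β ^ k / (k ! : ℝ) * ((cosMom k - cosMom (k + 2) : ℚ) : ℝ)|
      ≤ π * (2 * β ^ K / (K ! : ℝ)) := by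
  have hm : ∀ k : ℕ, ∫ α in (0 : ℝ)..π, Real.sin α ^ 2 * Real.cos α ^ k
      = π * ((cosMom k - cosMom (k + 2) : ℚ) : ℝ) := by
    intro k
    have hpt : (fun α => Real.sin α ^ 2 * Real.cos α ^ k)
        = fun α => Real.cos α ^ k - Real.cos α ^ (k + 2) := by
      funext α; rw [Real.sin_sq]; ring
    rw [hpt, intervalIntegral.integral_sub ((by fun_prop : Continuous fun α => Real.cos α ^ k).intervalIntegrable _ _)
      ((by fun_prop : Continuous fun α => Real.cos α ^ (k + 2)).intervalIntegrable _ _),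
      integral_cos_pow_eq_mul_cosMom Real.sin_pi k, integral_cos_pow_eq_mul_cosMom Real.sin_pi (k + 2)]
    push_cast
    ring
  have h1 : ∀ α, |Real.sin α ^ 2| ≤ 1 := fun α => by
    rw [abs_of_nonneg (sq_nonneg (Real.sin α))]
    exact Real.sin_sq_le_one α
  exact abs_integral_weight_exp_sub_le (w := fun α => Real.sin α ^ 2) (by fun_prop) h1
    Real.pi_pos.le hm hβ hK

/-- SU(2) numerator: `|∫_0^π cos α sin² α e^{β cos α} − π Σ_{k<K} β^k (r_{k+1} − r_{k+3})/k!| ≤ π · 2β^K/K!`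
(the integrand written as in `onePlaquetteExpectSU2`, `cos α · (sin² α · e^{β cos α})`). -/
theorem abs_onePlaquetteNSU2_sub_le {β : ℝ} (hβ : 0 ≤ β) {K : ℕ} (hK : 2 * β ≤ K + 1) :
    |(∫ α in (0 : ℝ)..π, Real.cos α * (Real.sin α ^ 2 * Real.exp (β * Real.cos α)))
      - π * ∑ k ∈ range K, β ^ k / (k ! : ℝ) * ((cosMom (k + 1) - cosMom (k + 3) : ℚ) : ℝ)|
      ≤ π * (2 * β ^ K / (K ! : ℝ)) := by
  have hm : ∀ k : ℕ, ∫ α in (0 : ℝ)..π, (Real.cos α * Real.sin α ^ 2) * Real.cos α ^ k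
      = π * ((cosMom (k + 1) - cosMom (k + 3) : ℚ) : ℝ) := by
    intro k
    have hpt : (fun α => (Real.cos α * Real.sin α ^ 2) * Real.cos α ^ k)
        = fun α => Real.cos α ^ (k + 1) - Real.cos α ^ (k + 3) := by
      funext α; rw [Real.sin_sq]; ring
    rw [hpt, intervalIntegral.integral_sub ((by fun_prop : Continuous fun α => Real.cos α ^ (k + 1)).intervalIntegrable _ _)
      ((by fun_prop : Continuous fun α => Real.cos α ^ (k + 3)).intervalIntegrable _ _),
      integral_cos_pow_eq_mul_cosMom Real.sin_pi (k + 1),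
      integral_cos_pow_eq_mul_cosMom Real.sin_pi (k + 3)]
    push_cast
    ring
  have h1 : ∀ α, |Real.cos α * Real.sin α ^ 2| ≤ 1 := fun α => by
    rw [abs_mul, abs_of_nonneg (sq_nonneg (Real.sin α))]
    calc |Real.cos α| * Real.sin α ^ 2 ≤ 1 * 1 := by
          gcongr
          · exact Real.abs_cos_le_one α
          · exact Real.sin_sq_le_one α
      _ = 1 := one_mul _
  have h := abs_integral_weight_exp_sub_le (w := fun α => Real.cos α * Real.sin α ^ 2) (by fun_prop) h1
    Real.pi_pos.le hm hβ hK
  have hpt2 : (fun α => Real.cos α * (Real.sin α ^ 2 * Real.exp (β * Real.cos α)))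
      = fun α => (Real.cos α * Real.sin α ^ 2) * Real.exp (β * Real.cos α) := by
    funext α; ring
  rw [hpt2]
  exact h

/-! ### 5. From two truncation bounds to an enclosure of the ratio -/

/-- If `N` and `Z` are within `L·t` of `L·n` and `L·z` (`L > 0`), `0 ≤ lo`, `t < z`, `t ≤ n`,
`lo (z + t) ≤ n − t` and `n + t ≤ hi (z − t)`, then `lo ≤ N/Z ≤ hi`. -/
theorem div_mem_of_abs_sub_le {N Z L n z t lo hi : ℝ} (hL : 0 < L)
    (hN : |N - L * n| ≤ L * t) (hZ : |Z - L * z| ≤ L * t)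
    (hlo0 : 0 ≤ lo) (htz : t < z) (htn : t ≤ n)
    (hlo : lo * (z + t) ≤ n - t) (hhi : n + t ≤ hi * (z - t)) :
    lo ≤ N / Z ∧ N / Z ≤ hi := by
  have ht0 : 0 ≤ t := by
    rcases le_or_gt 0 t with h | h
    · exact h
    · exact absurd ((abs_nonneg _).trans hN) (not_le.mpr (mul_neg_of_pos_of_neg hL h))
  rw [abs_le] at hN hZ
  obtain ⟨hN1, hN2⟩ := hN
  obtain ⟨hZ1, hZ2⟩ := hZ
  have hzt : 0 < z - t := by linarith
  have hZlow : L * (z - t) ≤ Z := by nlinarith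
  have hZpos : 0 < Z := lt_of_lt_of_le (mul_pos hL hzt) hZlow
  have hZup : Z ≤ L * (z + t) := by nlinarith
  have hNlow : L * (n - t) ≤ N := by nlinarith
  have hNup : N ≤ L * (n + t) := by nlinarith
  have hnt : 0 ≤ n + t := by linarith
  have hhi0 : 0 ≤ hi := by
    have h0 : 0 * (z - t) ≤ hi * (z - t) := by rw [zero_mul]; linarith
    exact le_of_mul_le_mul_right h0 hzt
  constructor
  · rw [le_div_iff₀ hZpos]
    calc lo * Z ≤ lo * (L * (z + t)) := by gcongr
      _ = L * (lo * (z + t)) := by ring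
      _ ≤ L * (n - t) := by gcongr
      _ ≤ N := hNlow
  · rw [div_le_iff₀ hZpos]
    calc N ≤ L * (n + t) := hNup
      _ ≤ L * (hi * (z - t)) := by gcongr
      _ = hi * (L * (z - t)) := by ring
      _ ≤ hi * Z := by gcongr

end Summit.Ventures.LatticeQCDFlow.Scoring
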